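import Mathlib
import Summits.NavierStokesRegularity.NavierStokesRegularity.Theorems.WakeRatchetTailRatchetRelayInverseBound
import HarnessLib

/-!
# `WakeRatchet.TailRatchet` (stmt-NavierStokesRegularity-21808): the LINEAR RESPONSE of the drain parameter
# — exact series for `∫ w₁·Res_s`, the factor `(2 − s)`, and the sign `ε₁(s) ≥ (2−s)/11360`

Support file for the crux `TailRatchet` (route `WakeRatchet`; MODEL lattice ODEs of Tao 2016 §1.2, §4 —
nothing in this file is a statement about the Navier–Stokes equations, and no item is closed here).

Context (programme "R-lac" of the census of stmt-21808, the SIGN LEMMA).  The first Picard iterate of the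
lacunary front construction has drain parameter `ε₁(s) = (∫w₁·(−Res_s))/(∫w₁·8e^{3t})`,
`Res_s(t) = e^{t} − (4/s²)e^{2t/s}`, `w₁ = Σ_m c_m e^{(2^m−1)t}` the adjoint mode.  Termwise integration gives the
EXACT series `∫w₁·(−Res_s) = Σ_m c_m q_m(s)`, `q_m(s) = 4/(s²(2^m−1)+2s) − 2^{−m}`, and the factorisation
`q_m(s) = (2−s)·p_m(s)`, `p_m(s) = (2^m(2+s) − s)/(2^m s(s(2^m−1)+2))`, exhibits the factor `2 − s` exactly:
`∫w₁·(−Res_s) = (2−s)·G(s)`, `G(s) = Σ_m c_m p_m(s)` continuous on `[3/2,2]` with `G(2) = τ < −1/8`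
(the transversality number of `…RelayTransversality`).  Hence, with `−1136 ≤ ∫w₁·8e^{3t} ≤ −3/10`:

* `linear_response_lower` — there is `η₁ > 0` with `ε₁(s) ≥ (2−s)/11360` for `2 − η₁ ≤ s ≤ 2`.

Combined with the second-order drain law `|δ_s − ε₁(s)| ≤ 10²²(2−s)²` of `…RelayFront`, the drain parameter of
the lacunary front is POSITIVE for `s < 2` close to `2`, i.e. `Λ = δ_s^{-1/2}` is a genuine (large) lattice
ratio (file `…LacunaryFront`).

HONEST FRAMING: elementary series bookkeeping; MODEL lattice only; lacunary fronts (LARGE `ε₀`) do NOT refute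
`TailRatchet` (which needs `Λ → 1`); the construction item and the crux stay open.
-/

noncomputable section

set_option linter.dupNamespace false

namespace Summit.NavierStokesRegularity.NavierStokesRegularity.Theorems

namespace WakeRatchetRelayLinearResponse

open Set Filter Topology MeasureTheory
open WakeRatchetRelayAdjoint WakeRatchetRelayTransversality WakeRatchetRelayInverseBound

/-! ## Termwise integration against `e^{kt}` -/

/-- Merging exponentials: `c_m e^{(2^m−1)t} e^{kt} = c_m e^{(2^m−1+k)t}`. [folklore] -/
theorem term_exp_eq (m : ℕ) (k t : ℝ) :
    (∏ i ∈ Finset.range m, ((-4 : ℝ) / (2 ^ (i + 1) - 1))) * Real.exp ((2 ^ m - 1) * t) * Real.exp (k * t) =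
      (∏ i ∈ Finset.range m, ((-4 : ℝ) / (2 ^ (i + 1) - 1))) * Real.exp ((2 ^ m - 1 + k) * t) := by
  rw [mul_assoc, ← Real.exp_add]; congr 2; ring

/-- Each term `c_m e^{(2^m−1)t} e^{kt}` (`k > 0`) is integrable on `(−∞,0]`. [folklore] -/
theorem term_exp_integrableOn (m : ℕ) {k : ℝ} (hk : 0 < k) :
    IntegrableOn (fun t : ℝ => (∏ i ∈ Finset.range m, ((-4 : ℝ) / (2 ^ (i + 1) - 1))) *
      Real.exp ((2 ^ m - 1) * t) * Real.exp (k * t)) (Iic 0) := by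
  have h : (fun t : ℝ => (∏ i ∈ Finset.range m, ((-4 : ℝ) / (2 ^ (i + 1) - 1))) *
      Real.exp ((2 ^ m - 1) * t) * Real.exp (k * t)) = fun t : ℝ =>
      (∏ i ∈ Finset.range m, ((-4 : ℝ) / (2 ^ (i + 1) - 1))) * Real.exp ((2 ^ m - 1 + k) * t) :=
    funext fun t => term_exp_eq m k t
  rw [h]
  have hk' : 0 < (2 : ℝ) ^ m - 1 + k := by linarith [one_le_two_pow_real m]
  exact (integrableOn_exp_mul_Iic hk' 0).const_mul _

/-- Termwise integral: `∫_{(−∞,0]} c_m e^{(2^m−1)t} e^{kt} dt = c_m/(2^m − 1 + k)` (`k > 0`). [folklore] -/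
theorem term_exp_integral (m : ℕ) {k : ℝ} (hk : 0 < k) :
    ∫ t in Iic (0 : ℝ), (∏ i ∈ Finset.range m, ((-4 : ℝ) / (2 ^ (i + 1) - 1))) *
      Real.exp ((2 ^ m - 1) * t) * Real.exp (k * t) =
      (∏ i ∈ Finset.range m, ((-4 : ℝ) / (2 ^ (i + 1) - 1))) * (1 / (2 ^ m - 1 + k)) := by
  have h : (fun t : ℝ => (∏ i ∈ Finset.range m, ((-4 : ℝ) / (2 ^ (i + 1) - 1))) *
      Real.exp ((2 ^ m - 1) * t) * Real.exp (k * t)) = fun t : ℝ =>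
      (∏ i ∈ Finset.range m, ((-4 : ℝ) / (2 ^ (i + 1) - 1))) * Real.exp ((2 ^ m - 1 + k) * t) :=
    funext fun t => term_exp_eq m k t
  have hk' : 0 < (2 : ℝ) ^ m - 1 + k := by linarith [one_le_two_pow_real m]
  rw [h, integral_const_mul, integral_exp_mul_Iic_zero hk']

/-- Termwise norm bound: `∫_{(−∞,0]} ‖c_m e^{(2^m−1)t} e^{kt}‖ ≤ 210·4^{−m}` for `k ≥ 1`. [folklore] -/
theorem term_exp_norm_integral_le (m : ℕ) {k : ℝ} (hk : 1 ≤ k) :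
    ∫ t in Iic (0 : ℝ), ‖(∏ i ∈ Finset.range m, ((-4 : ℝ) / (2 ^ (i + 1) - 1))) *
      Real.exp ((2 ^ m - 1) * t) * Real.exp (k * t)‖ ≤ 210 / 4 ^ m := by
  have hk' : 0 < (2 : ℝ) ^ m - 1 + k := by linarith [one_le_two_pow_real m]
  have h : (fun t : ℝ => ‖(∏ i ∈ Finset.range m, ((-4 : ℝ) / (2 ^ (i + 1) - 1))) *
      Real.exp ((2 ^ m - 1) * t) * Real.exp (k * t)‖) = fun t : ℝ =>
      |∏ i ∈ Finset.range m, ((-4 : ℝ) / (2 ^ (i + 1) - 1))| * Real.exp ((2 ^ m - 1 + k) * t) := by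
    funext t
    rw [term_exp_eq, Real.norm_eq_abs, abs_mul, abs_of_pos (Real.exp_pos _)]
  rw [h, integral_const_mul, integral_exp_mul_Iic_zero hk']
  have h1 : 1 / ((2 : ℝ) ^ m - 1 + k) ≤ 1 := by
    rw [div_le_iff₀ hk']; linarith [one_le_two_pow_real m]
  calc |∏ i ∈ Finset.range m, ((-4 : ℝ) / (2 ^ (i + 1) - 1))| * (1 / (2 ^ m - 1 + k))
      ≤ 210 / 4 ^ m * 1 := mul_le_mul (coeff_abs_le m) h1 (by positivity) (by positivity)
    _ = 210 / 4 ^ m := mul_one _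

/-- **`∫_{(−∞,0]} w₁(t) e^{kt} dt = Σ_m c_m/(2^m − 1 + k)`** for `k ≥ 1` (termwise integration).
[cite: Tao2016AveragedNS, §1.2 (dyadic model); cell vocabulary (adjoint mode; programme R-lac)] -/
theorem integral_adjoint_exp_mul {k : ℝ} (hk : 1 ≤ k) :
    ∫ t in Iic (0 : ℝ), (∑' m : ℕ, (∏ i ∈ Finset.range m, ((-4 : ℝ) / (2 ^ (i + 1) - 1))) *
        Real.exp ((2 ^ m - 1) * t)) * Real.exp (k * t) =
      ∑' m : ℕ, (∏ i ∈ Finset.range m, ((-4 : ℝ) / (2 ^ (i + 1) - 1))) * (1 / (2 ^ m - 1 + k)) := by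
  have hk0 : 0 < k := by linarith
  have h : (fun t : ℝ => (∑' m : ℕ, (∏ i ∈ Finset.range m, ((-4 : ℝ) / (2 ^ (i + 1) - 1))) *
        Real.exp ((2 ^ m - 1) * t)) * Real.exp (k * t)) = fun t : ℝ => ∑' m : ℕ,
        (∏ i ∈ Finset.range m, ((-4 : ℝ) / (2 ^ (i + 1) - 1))) * Real.exp ((2 ^ m - 1) * t) *
          Real.exp (k * t) := by
    funext t; rw [tsum_mul_right]
  have hsum : Summable (fun m : ℕ => ∫ t in Iic (0 : ℝ),
      ‖(∏ i ∈ Finset.range m, ((-4 : ℝ) / (2 ^ (i + 1) - 1))) * Real.exp ((2 ^ m - 1) * t) *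
        Real.exp (k * t)‖) :=
    Summable.of_nonneg_of_le (fun m => integral_nonneg fun t => norm_nonneg _)
      (fun m => term_exp_norm_integral_le m hk) summable_majorant
  rw [h, ← integral_tsum_of_summable_integral_norm (fun m => term_exp_integrableOn m hk0) hsum]
  exact tsum_congr fun m => term_exp_integral m hk0

/-! ## The exact series for `∫ w₁·(−Res_s)` and the factor `2 − s` -/

/-- The factorisation `4/(s²(2^m−1)+2s) − 2^{−m} = (2−s)·(2^m(2+s) − s)/(2^m s (s(2^m−1)+2))` (`s > 0`).
[folklore] -/
theorem q_factor (m : ℕ) {s : ℝ} (hs : 0 < s) :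
    4 / s ^ 2 * (1 / (2 ^ m - 1 + 2 / s)) - 1 / 2 ^ m =
      (2 - s) * ((2 ^ m * (2 + s) - s) / (2 ^ m * s * (s * (2 ^ m - 1) + 2))) := by
  have h2 : (0 : ℝ) < 2 ^ m := by positivity
  have hden : 0 < s * ((2 : ℝ) ^ m - 1) + 2 := by nlinarith [one_le_two_pow_real m]
  have hden' : (2 : ℝ) ^ m - 1 + 2 / s = (s * (2 ^ m - 1) + 2) / s := by
    field_simp
  rw [hden']
  field_simp
  ring

/-- Bound for the factor: `0 ≤ p_m(s) ≤ 2·2^{−m}` on `3/2 ≤ s ≤ 2`. [folklore] -/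
theorem p_bounds (m : ℕ) {s : ℝ} (hs1 : 3 / 2 ≤ s) (hs2 : s ≤ 2) :
    0 ≤ (2 ^ m * (2 + s) - s) / (2 ^ m * s * (s * (2 ^ m - 1) + 2)) ∧
      (2 ^ m * (2 + s) - s) / (2 ^ m * s * (s * (2 ^ m - 1) + 2)) ≤ 2 / 2 ^ m := by
  have h1 := one_le_two_pow_real m
  have h2 : (0 : ℝ) < 2 ^ m := by positivity
  have hnum : 0 ≤ (2 : ℝ) ^ m * (2 + s) - s := by nlinarith
  have hden : 0 < (2 : ℝ) ^ m * s * (s * (2 ^ m - 1) + 2) := by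
    have : 0 < s * ((2 : ℝ) ^ m - 1) + 2 := by nlinarith
    positivity
  refine ⟨div_nonneg hnum hden.le, ?_⟩
  rw [div_le_div_iff₀ hden h2]
  -- `(2^m(2+s) − s)·2^m ≤ 2·2^m s (s(2^m−1)+2)`
  have h3 : (2 : ℝ) ^ m * (2 + s) - s ≤ 4 * 2 ^ m := by nlinarith
  have h4 : 2 * (2 : ℝ) ^ m ≤ s * (s * (2 ^ m - 1) + 2) := by nlinarith
  nlinarith

/-- **EXACT SERIES WITH THE FACTOR `2 − s`.**  For `3/2 ≤ s ≤ 2`: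
`∫_{(−∞,0]} w₁(t)·(−(e^{t} − (4/s²)e^{2t/s})) dt = (2 − s) · Σ_m c_m p_m(s)`,
`p_m(s) = (2^m(2+s) − s)/(2^m s (s(2^m−1)+2))`.
[cite: Tao2016AveragedNS, §1.2 (dyadic model); cell vocabulary (linear response of the drain parameter at the relay profile; programme R-lac)] -/
theorem response_series {s : ℝ} (hs1 : 3 / 2 ≤ s) (hs2 : s ≤ 2) :
    ∫ t in Iic (0 : ℝ), (∑' m : ℕ, (∏ i ∈ Finset.range m, ((-4 : ℝ) / (2 ^ (i + 1) - 1))) *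
        Real.exp ((2 ^ m - 1) * t)) * (-(Real.exp t - 4 / s ^ 2 * Real.exp (2 * t / s))) =
      (2 - s) * ∑' m : ℕ, (∏ i ∈ Finset.range m, ((-4 : ℝ) / (2 ^ (i + 1) - 1))) *
        ((2 ^ m * (2 + s) - s) / (2 ^ m * s * (s * (2 ^ m - 1) + 2))) := by
  have hs0 : 0 < s := by linarith
  have hk1 : (1 : ℝ) ≤ 1 := le_rfl
  have hk2 : (1 : ℝ) ≤ 2 / s := by rw [le_div_iff₀ hs0]; linarith
  set W : ℝ → ℝ := fun t : ℝ => ∑' m : ℕ,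
      (∏ i ∈ Finset.range m, ((-4 : ℝ) / (2 ^ (i + 1) - 1))) * Real.exp ((2 ^ m - 1) * t) with hW
  -- integrability of the two pieces
  have hWc : ContinuousOn W (Iic 0) := WakeRatchetRelayGreen.adjoint_continuousOn
  have hint : ∀ {k : ℝ}, 0 < k → IntegrableOn (fun t => W t * Real.exp (k * t)) (Iic 0) := by
    intro k hk
    have hg : IntegrableOn (fun t : ℝ => 71 * Real.exp (k * t)) (Iic 0) :=
      (integrableOn_exp_mul_Iic hk 0).const_mul _
    refine Integrable.mono' hg ?_ ?_
    · exact (hWc.mul (Real.continuous_exp.comp (continuous_const.mul continuous_id)).continuousOn)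
        |>.aestronglyMeasurable measurableSet_Iic
    · refine (ae_restrict_iff' measurableSet_Iic).2 (Eventually.of_forall fun t ht => ?_)
      rw [norm_mul, Real.norm_eq_abs, Real.norm_eq_abs, abs_of_pos (Real.exp_pos _)]
      exact mul_le_mul_of_nonneg_right (WakeRatchetRelayGreen.adjoint_abs_le ht) (Real.exp_pos _).le
  have h1 : (fun t : ℝ => W t * (-(Real.exp t - 4 / s ^ 2 * Real.exp (2 * t / s)))) =
      fun t : ℝ => 4 / s ^ 2 * (W t * Real.exp (2 / s * t)) - W t * Real.exp (1 * t) := by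
    funext t
    have : 2 * t / s = 2 / s * t := by ring
    rw [this, one_mul]; ring
  rw [h1, integral_sub ((hint (by positivity)).const_mul _) (hint one_pos), integral_const_mul]
  simp only [hW]
  rw [integral_adjoint_exp_mul hk1, integral_adjoint_exp_mul hk2]
  -- combine the two series termwise
  have hS1 : Summable (fun m : ℕ => (∏ i ∈ Finset.range m, ((-4 : ℝ) / (2 ^ (i + 1) - 1))) *
      (1 / (2 ^ m - 1 + 1))) := by
    refine Summable.of_norm_bounded summable_majorant fun m => ?_
    rw [Real.norm_eq_abs, abs_mul]
    have h2 : (0 : ℝ) < 2 ^ m := by positivity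
    have : |1 / ((2 : ℝ) ^ m - 1 + 1)| ≤ 1 := by
      rw [show (2 : ℝ) ^ m - 1 + 1 = 2 ^ m by ring, abs_of_pos (by positivity), div_le_iff₀ h2]
      linarith [one_le_two_pow_real m]
    calc _ ≤ 210 / 4 ^ m * 1 := mul_le_mul (coeff_abs_le m) this (abs_nonneg _) (by positivity)
      _ = 210 / 4 ^ m := mul_one _
  have hS2 : Summable (fun m : ℕ => (∏ i ∈ Finset.range m, ((-4 : ℝ) / (2 ^ (i + 1) - 1))) *
      (1 / (2 ^ m - 1 + 2 / s))) := by
    refine Summable.of_norm_bounded summable_majorant fun m => ?_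
    rw [Real.norm_eq_abs, abs_mul]
    have hpos : (0 : ℝ) < 2 ^ m - 1 + 2 / s := by linarith [one_le_two_pow_real m]
    have : |1 / ((2 : ℝ) ^ m - 1 + 2 / s)| ≤ 1 := by
      rw [abs_of_pos (by positivity), div_le_iff₀ hpos]; linarith [one_le_two_pow_real m]
    calc _ ≤ 210 / 4 ^ m * 1 := mul_le_mul (coeff_abs_le m) this (abs_nonneg _) (by positivity)
      _ = 210 / 4 ^ m := mul_one _
  rw [← tsum_mul_left, ← (hS2.mul_left _).tsum_sub hS1, ← tsum_mul_left]
  refine tsum_congr fun m => ?_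
  have hq := q_factor m hs0
  rw [show (2 : ℝ) ^ m - 1 + 1 = 2 ^ m by ring]
  calc 4 / s ^ 2 * ((∏ i ∈ Finset.range m, ((-4 : ℝ) / (2 ^ (i + 1) - 1))) * (1 / (2 ^ m - 1 + 2 / s))) -
        (∏ i ∈ Finset.range m, ((-4 : ℝ) / (2 ^ (i + 1) - 1))) * (1 / 2 ^ m)
      = (∏ i ∈ Finset.range m, ((-4 : ℝ) / (2 ^ (i + 1) - 1))) *
          (4 / s ^ 2 * (1 / (2 ^ m - 1 + 2 / s)) - 1 / 2 ^ m) := by ring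
    _ = _ := by rw [hq]; ring

/-! ## Continuity of the reduced response and its value at `s = 2` -/

/-- The reduced response `G(s) = Σ_m c_m p_m(s)` is continuous on `[3/2, 2]`. [folklore] -/
theorem response_continuousOn :
    ContinuousOn (fun s : ℝ => ∑' m : ℕ, (∏ i ∈ Finset.range m, ((-4 : ℝ) / (2 ^ (i + 1) - 1))) *
        ((2 ^ m * (2 + s) - s) / (2 ^ m * s * (s * (2 ^ m - 1) + 2)))) (Icc (3 / 2) 2) := by
  have hu : Summable (fun m : ℕ => (210 : ℝ) / 4 ^ m * (2 / 2 ^ m)) := by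
    have h : Summable (fun m : ℕ => (420 : ℝ) * (1 / 8) ^ m) :=
      (summable_geometric_of_lt_one (by norm_num) (by norm_num)).mul_left 420
    refine h.congr fun m => ?_
    have h8 : (8 : ℝ) ^ m = 4 ^ m * 2 ^ m := by rw [← mul_pow]; norm_num
    rw [one_div, inv_pow, h8]
    field_simp
    ring
  refine continuousOn_tsum (fun m => ?_) hu (fun m s hs => ?_)
  · have h1 := one_le_two_pow_real m
    refine ContinuousOn.mul continuousOn_const (ContinuousOn.div (by fun_prop) (by fun_prop) ?_)
    intro s hs
    have hs1 : (3 : ℝ) / 2 ≤ s := hs.1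
    have : 0 < s * ((2 : ℝ) ^ m - 1) + 2 := by nlinarith
    positivity
  · obtain ⟨hp0, hp1⟩ := p_bounds m hs.1 hs.2
    rw [norm_mul, Real.norm_eq_abs, Real.norm_eq_abs, abs_of_nonneg hp0]
    exact mul_le_mul (coeff_abs_le m) hp1 hp0 (by positivity)

/-- At `s = 2` the reduced response is the transversality series: `p_m(2) = 2^{−m} − ½·4^{−m}`, so
`G(2) = Σ_m c_m(2^{−m} − ½·4^{−m}) ≤ −1/8`. [folklore] -/
theorem response_at_two :
    ∑' m : ℕ, (∏ i ∈ Finset.range m, ((-4 : ℝ) / (2 ^ (i + 1) - 1))) *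
        ((2 ^ m * (2 + 2) - 2) / (2 ^ m * 2 * (2 * (2 ^ m - 1) + 2))) ≤ -1 / 8 := by
  have hterm : ∀ m : ℕ, ((2 : ℝ) ^ m * (2 + 2) - 2) / (2 ^ m * 2 * (2 * (2 ^ m - 1) + 2)) =
      1 / 2 ^ m - 1 / (2 * (2 ^ m) ^ 2) := by
    intro m
    have h2 : (0 : ℝ) < 2 ^ m := by positivity
    field_simp
    ring
  simp_rw [hterm]
  rw [← summable_tsum_term.sum_add_tsum_nat_add 6, head_six_eq]
  have htail := tail_six_abs_le
  rw [Real.norm_eq_abs] at htail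
  have := (abs_le.1 htail).2
  norm_num at this ⊢
  linarith

/-! ## The sign of the linear response -/

/-- `|∫_{(−∞,0]} w₁·8e^{3t}| ≤ 1136` (crude, from `|w₁| ≤ 71`). [folklore] -/
theorem drain_functional_abs_le :
    |∫ t in Iic (0 : ℝ), (∑' m : ℕ, (∏ i ∈ Finset.range m, ((-4 : ℝ) / (2 ^ (i + 1) - 1))) *
        Real.exp ((2 ^ m - 1) * t)) * (8 * Real.exp (3 * t))| ≤ 1136 := by
  have hA : ∀ t : ℝ, t ≤ 0 → |8 * Real.exp (3 * t)| ≤ 8 * Real.exp (t / 2) := by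
    intro t ht
    rw [abs_mul, abs_of_pos (Real.exp_pos _), show |(8 : ℝ)| = 8 by norm_num]
    exact mul_le_mul_of_nonneg_left (Real.exp_le_exp.2 (by linarith)) (by norm_num)
  have := adjoint_pairing_abs_le (φ := fun t => 8 * Real.exp (3 * t)) (by fun_prop) hA
  linarith

/-- **THE LINEAR RESPONSE IS POSITIVE, QUANTITATIVELY.**  There is `η₁ > 0` such that for
`2 − η₁ ≤ s ≤ 2` the drain parameter of the first Picard iterate satisfies
`ε₁(s) = (∫w₁·(−Res_s))/(∫w₁·8e^{3t}) ≥ (2 − s)/11360`.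
[cite: Tao2016AveragedNS, §1.2 (dyadic model); cell vocabulary (linear response of the drain parameter at the relay profile; programme R-lac, sign lemma)] -/
theorem linear_response_lower :
    ∃ η₁ : ℝ, 0 < η₁ ∧ ∀ s : ℝ, 2 - η₁ ≤ s → s ≤ 2 →
      (2 - s) / 11360 ≤
        (∫ t in Iic (0 : ℝ), (∑' m : ℕ, (∏ i ∈ Finset.range m, ((-4 : ℝ) / (2 ^ (i + 1) - 1))) *
              Real.exp ((2 ^ m - 1) * t)) * (-(Real.exp t - 4 / s ^ 2 * Real.exp (2 * t / s)))) /
          (∫ t in Iic (0 : ℝ), (∑' m : ℕ, (∏ i ∈ Finset.range m, ((-4 : ℝ) / (2 ^ (i + 1) - 1))) *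
              Real.exp ((2 ^ m - 1) * t)) * (8 * Real.exp (3 * t))) := by
  set G : ℝ → ℝ := fun s : ℝ => ∑' m : ℕ, (∏ i ∈ Finset.range m, ((-4 : ℝ) / (2 ^ (i + 1) - 1))) *
        ((2 ^ m * (2 + s) - s) / (2 ^ m * s * (s * (2 ^ m - 1) + 2))) with hG
  set ℓ : ℝ := ∫ t in Iic (0 : ℝ), (∑' m : ℕ, (∏ i ∈ Finset.range m, ((-4 : ℝ) / (2 ^ (i + 1) - 1))) *
      Real.exp ((2 ^ m - 1) * t)) * (8 * Real.exp (3 * t)) with hℓ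
  have hℓneg : ℓ ≤ -3 / 10 := drain_functional_le
  have hℓabs : |ℓ| ≤ 1136 := drain_functional_abs_le
  have hℓlow : -1136 ≤ ℓ := (abs_le.1 hℓabs).1
  -- continuity of `G` at `2` within `[3/2, 2]`
  have hGc : ContinuousWithinAt G (Icc (3 / 2) 2) 2 :=
    response_continuousOn.continuousWithinAt ⟨by norm_num, le_rfl⟩
  have hG2 : G 2 ≤ -1 / 8 := response_at_two
  have hev : ∀ᶠ s in 𝓝[Icc (3 / 2) 2] 2, G s < -1 / 10 :=
    hGc (Iio_mem_nhds (by linarith))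
  obtain ⟨u, hu, hball⟩ := Metric.eventually_nhds_iff.1 (eventually_nhdsWithin_iff.1 hev)
  refine ⟨min u (1 / 2) / 2, by positivity, fun s hsl hsu => ?_⟩
  have hmin1 := min_le_left u (1 / 2 : ℝ)
  have hmin2 := min_le_right u (1 / 2 : ℝ)
  have hs32 : (3 : ℝ) / 2 ≤ s := by linarith
  have hGs : G s < -1 / 10 := by
    have hmem : s ∈ Icc (3 / 2 : ℝ) 2 := ⟨hs32, hsu⟩
    have hdist : dist s 2 < u := by
      rw [Real.dist_eq, abs_sub_comm, abs_of_nonneg (by linarith)]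
      linarith
    exact hball hdist hmem
  rw [response_series hs32 hsu]
  -- `(2−s)·G(s)/ℓ ≥ (2−s)/11360`
  have h2s : 0 ≤ 2 - s := by linarith
  have hℓ0 : ℓ < 0 := by linarith
  rw [show (2 - s) * G s / ℓ = (2 - s) * (G s / ℓ) by ring]
  have hq : 1 / 11360 ≤ G s / ℓ := by
    have hnegℓ : 0 < -ℓ := by linarith
    have key : 1 / 11360 ≤ (-G s) / (-ℓ) := by
      rw [le_div_iff₀ hnegℓ]; nlinarith
    rwa [neg_div_neg_eq] at key
  calc (2 - s) / 11360 = (2 - s) * (1 / 11360) := by ring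
    _ ≤ (2 - s) * (G s / ℓ) := mul_le_mul_of_nonneg_left hq h2s

end WakeRatchetRelayLinearResponse

end Summit.NavierStokesRegularity.NavierStokesRegularity.Theorems

end
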